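import Literature.NumberTheory.LFunctions.Zhang2022.PartIIIEndgameRows
import Literature.NumberTheory.LFunctions.Zhang2022.Section2AllIota

/-!
# Zhang (2022) Part III: the endgame rows against the certified main-order constants — jointly unsatisfiable

Trunk T-ANT (NumberTheory/LFunctions). Y. Zhang, *Discrete mean estimates and the Landau–Siegel
zero*, arXiv:2211.02515v1 (2022) [Zhang2022LandauSiegel] — an unrefereed manuscript under
adjudication (cell pub-zhang: audit + repair census; **no claim about Landau–Siegel**). **Nothing in
this file asserts or denies its Theorems 1–2, its Propositions 2.1–2.6, 14.1, or any analytic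
lemma.** It is the third module of the cell's Part III constraint layer (unit b2b-zhang-dep-3) and
closes the brief's second half — "`admissible(params) → conclusion`, AND the hypotheses shown jointly
unsatisfiable" — at the level of the design record `PartIIIDesign`:

* `PartIIIConstraints` proved `Admissible p → ConclusionPartIII p` (the §2 skeleton closes at the
  constants of ANY admissible design `p`, pure real arithmetic);
* the numerics modules certified the manuscript's OWN main-order constants for every choice of the
  mollifier coefficients `ι = (ι₂, ι₃, ι₄) ↦ (w₂, w₃, w₄)`: the (2.32)-side `C₂₃₂(ι) = 𝔠₁ + 𝔠₂ + 2Re 𝔠₃`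
  (`Section18AllIota.C232G`, `C232cG`; `≥ 0.0309` resp. `≥ 0.0249`), the (2.33)-side `C₂₃₃ > 2546.84`
  (`Section10Certificate.C233_bounds`; literal reading `C233lit`), and Prop. 2.4's `|𝔡′(ι) + 𝔡(ι)|² ≤
  832·C₂₃₂(ι)` (`Section2AllIota.normSq_dsumG_le_p`, `≤ 1040·C232cG`), whence
  `Section2AllIota.not_mainOrderContradictionG_all`: `¬ √(C₂₃₂(ι)·C₂₃₃) < |𝔡′(ι) + 𝔡(ι)|` for every `ι`.

Here the two are JOINED. `MainOrderDeliverable p c₂ c₂₃₃ w₂ w₃ w₄` says that the five thresholded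
inputs of the §2 endgame at design `p` — (8.23)+(8.24) `Ξ₁₁ ≤ (B824+η)𝔞𝔓`, (9.7)+(9.8), (18.1)+(18.2),
(2.33) `Ξ_J ≤ cJ·𝔞𝔓`, Prop. 2.4 `|Ξ₁*| ≥ d24·𝔞𝔓` — are not on the wrong side of the method's own
main terms at `ι` (`𝔠₁(w₂).re ≤ B824`, `𝔠₂(w₃,w₄).re ≤ B98`, `Re 𝔠₃(ι) ≤ B182`, `C₂₃₃ ≤ cJ`,
`d24 ≤ |𝔡′(ι) + 𝔡(ι)|`): the manuscript evaluates `Ξ₁₁ ∼ 𝔠₁(ι)𝔞𝔓`, …, `|Ξ₁*| ∼ |𝔡′ + 𝔡|𝔞𝔓` (§§8–10,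
18), so an input with a threshold beyond its main term is not supplied by those evaluations for small
`η` — this is bookkeeping of WHICH constants the §2 skeleton may be fed, not an analytic statement.
The theorems:

* `mainOrderContradictionG_of_endgameArithmetic`: the rows `√(q232·cJ) < c25 < d24` (III-2.P25a/b,
  III-2.asm) turn threshold domination `c₂₃₂ ≤ q232`, `c₂₃₃ ≤ cJ`, `d24 ≤ |𝔡′(ι)+𝔡(ι)|` into the
  main-order contradiction `√(c₂₃₂·c₂₃₃) < |𝔡′(ι)+𝔡(ι)|` (monotonicity of `√`);
* `not_endgameArithmetic_of_deliverable` (all four readings `c₃₄` printed / `0.5`-prefactor ×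
  `C₂₃₃` / `C233lit`, every `ι`, every design): deliverable thresholds ⇒ `¬ EndgameArithmetic p`;
  hence `not_exists_admissible_deliverable`, `not_exists_endgameRows_deliverable` — **no Part-III
  design is both admissible and main-order deliverable, for any `ι`**: the cell's CANNOT-CLOSE for the
  terminal block as ONE kernel statement over the row layer (census rows N-III.inv / N-III.18sum,
  `constraints/part3.json`; REPAIR-CENSUS "best certified exponent A: none" — `A` does not occur);
* `not_endgameArithmetic_of_deliverable_robust`: the same with the (2.32)-side thresholds allowed to
  undershoot `C232cG(ι)` by any `δ ≤ 0.014` (the manuscript's `ε`-terms `< 10⁻⁵`, the unreduced `𝔠₃`,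
  …; `Section2AllIota.not_mainOrderContradictionG_robust`);
* `not_endgameRows_of_thresholds`: for the LITERAL row block the (2.33)-input is automatic — row
  III-18.03f (the manuscript's own proof of (2.33)) pins `cJ > 2·4400/π > 2801 > C233lit`
  (`C233_lt_cJ_of_endgameRows`) — so the rows fail on the three `𝔠`-thresholds (robustly) and
  Prop. 2.4's size alone;
* the CYCLE is genuine — each side is satisfiable alone: `printed_endgameArithmetic` (tree) with
  `printed_deliverable_tail` (the printed `cJ = 3000 ≥ C₂₃₃`, `d24 = 5 ≤ |𝔡′+𝔡|` ARE deliverable) but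
  `printed_not_deliverable` (the three `𝔠`-thresholds sum to `0.0008 < 0.0249 ≤ C₂₃₂(ι)`, every `ι`,
  every reading); `raised_deliverable` (thresholds raised to `7.06, 7, −6.99`, all else printed:
  deliverable at the printed `ι`, support/shift rows intact) but `raised_not_endgameArithmetic`; and
  `dropH24_witness` (without Prop. 2.4's certified size `|𝔡′+𝔡| < 5.2991` the remaining hypotheses are
  jointly satisfiable: `q232 = 0.1, c25 = 18, d24 = 19`), so `Section10Certificate.dsum_norm*` is
  load-bearing in the cycle. The binding chain, in numbers: `q232 ≥ C₂₃₂(ι) ≥ 0.0249`, `cJ ≥ 2546.84`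
  ⇒ `√(q232·cJ) ≥ 7.96`, against `c25 < d24 ≤ |𝔡′(ι)+𝔡(ι)| ≤ √(1040·C₂₃₂(ι))`, i.e. closing would need
  `C₂₃₃ < 1040` (`Section2AllIota.mainOrderG_threshold`).

Real arithmetic over a parameter record plus the cell's certified brackets; no Dirichlet series, no
discrete mean, no `o(·)`; the ε-terms of (18.1)–(18.2) enter only through the robust form. Companion
files: `PartIIIConstraints`, `PartIIIEndgameRows` (rows), `Section2MainOrder` / `Section2AllIota`
(printed-`ι` / all-`ι` main order), `MainTermForm*` (designs beyond the manuscript's family — not used here).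
-/

noncomputable section

open Complex Real ComplexConjugate

namespace Literature.NumberTheory.LFunctions.Zhang2022

namespace PartIIIDesign

/-- **Main-order deliverability of the endgame thresholds of design `p` at mollifier coefficients
`(ι₂, ι₃, ι₄) = (w₂, w₃, w₄)`**, with a selectable (9.1)-constant `c₂` (`frakc2G`: printed `c₃₄`;
`frakc2cG`: the `0.5`-prefactor reading) and (2.33)-constant `c₂₃₃` (`C233` from (10.19) as printed, or
`C233lit`): the thresholds `B824, B98, B182` of (8.24), (9.8), (18.2) are at least the method's main-order
constants `Re 𝔠₁(w₂)`, `Re 𝔠₂(w₃,w₄)`, `Re 𝔠₃(ι)` (`Ξ₁₁ ∼ 𝔠₁𝔞𝔓` (8.23), `Ξ₁₂ ∼ 𝔠₂𝔞𝔓` (9.7),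
`Ξ₁₃ ∼ 𝔠₃𝔞𝔓` (18.1)); the (2.33) threshold `cJ` is at least `c₂₃₃` (`Ξ_J ∼ C₂₃₃𝔞𝔓`, §10/§18); and
Prop. 2.4's `d24` is at most `|𝔡′(ι) + 𝔡(ι)|` (`Ξ₁* ∼ (𝔡′ + 𝔡)𝔞𝔓`, (10.17)). A `Prop`-valued record of
WHICH constants the manuscript's evaluations can feed to the §2 skeleton (`EndgameInputs`) as `η → 0`;
it asserts nothing about those evaluations. [cite: Zhang2022LandauSiegel, (8.23)–(8.24), (9.7)–(9.8),
(18.1)–(18.2), (2.33), (10.17), Prop. 2.4] -/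
structure MainOrderDeliverable (p : PartIIIDesign) (c2 : ℂ → ℂ → ℂ) (c233 : ℝ) (w2 w3 w4 : ℂ) : Prop where
  /-- (8.24) at main order: `Re 𝔠₁(w₂) ≤ B824` -/
  h824 : (frakc1G w2).re ≤ p.B824
  /-- (9.8) at main order: `Re 𝔠₂(w₃, w₄) ≤ B98` -/
  h98 : (c2 w3 w4).re ≤ p.B98
  /-- (18.2) at main order (reduced `𝔠₃`): `Re 𝔠₃(ι) ≤ B182` -/
  h182 : (frakc3rG w2 w3 w4).re ≤ p.B182
  /-- (2.33) at main order: `C₂₃₃ ≤ cJ` -/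
  h233 : c233 ≤ p.cJ
  /-- Prop. 2.4 at main order: `d24 ≤ |𝔡′(ι) + 𝔡(ι)|` -/
  h24 : p.d24 ≤ ‖dprimeG w3 + dfrakG w2 w3 w4‖

/-! ### The bridge: rows + threshold domination ⇒ the main-order contradiction -/

/-- **Rows ⇒ main-order contradiction.** If `p` satisfies the endgame arithmetic (`0 ≤ q232`,
`√(q232·cJ) < c25 < d24`, …) and its thresholds dominate constants `c₂₃₂ ≤ q232`, `0 ≤ c₂₃₃ ≤ cJ`,
`d24 ≤ |𝔡′(ι) + 𝔡(ι)|`, then `√(c₂₃₂·c₂₃₃) ≤ √(q232·cJ) < c25 < d24 ≤ |𝔡′(ι) + 𝔡(ι)|`, i.e.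
`MainOrderContradictionG w₂ w₃ w₄ c₂₃₂ c₂₃₃`. [folklore] -/
theorem mainOrderContradictionG_of_endgameArithmetic (p : PartIIIDesign) (h : p.EndgameArithmetic)
    {w2 w3 w4 : ℂ} {c232 c233 : ℝ} (hc233 : 0 ≤ c233) (h232 : c232 ≤ p.q232) (h233 : c233 ≤ p.cJ)
    (h24 : p.d24 ≤ ‖dprimeG w3 + dfrakG w2 w3 w4‖) : MainOrderContradictionG w2 w3 w4 c232 c233 := by
  obtain ⟨hq, _, hsqrt, hcd, _⟩ := h
  unfold MainOrderContradictionG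
  have hmono : c232 * c233 ≤ p.q232 * p.cJ := mul_le_mul h232 h233 hc233 hq
  calc Real.sqrt (c232 * c233) ≤ Real.sqrt (p.q232 * p.cJ) := Real.sqrt_le_sqrt hmono
    _ < p.c25 := hsqrt
    _ < p.d24 := hcd
    _ ≤ ‖dprimeG w3 + dfrakG w2 w3 w4‖ := h24

/-- The three `𝔠`-thresholds of a deliverable design dominate `C₂₃₂(ι)` in the printed-`c₃₄` reading, and
with row III-18.02b (`B824 + B98 + 2·B182 < q232`) so does `q232`. [folklore] -/
theorem C232G_le_of_deliverable (p : PartIIIDesign) {c233 : ℝ} {w2 w3 w4 : ℂ}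
    (hd : p.MainOrderDeliverable frakc2G c233 w2 w3 w4) :
    C232G w2 w3 w4 ≤ p.B824 + p.B98 + 2 * p.B182 := by
  unfold C232G
  linarith [hd.h824, hd.h98, hd.h182]

/-- The same in the `0.5`-prefactor reading of `c₃₄` (`C232cG`). [folklore] -/
theorem C232cG_le_of_deliverable (p : PartIIIDesign) {c233 : ℝ} {w2 w3 w4 : ℂ}
    (hd : p.MainOrderDeliverable frakc2cG c233 w2 w3 w4) :
    C232cG w2 w3 w4 ≤ p.B824 + p.B98 + 2 * p.B182 := by
  unfold C232cG
  linarith [hd.h824, hd.h98, hd.h182]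

/-! ### Joint unsatisfiability, every `ι`, all four readings -/

/-- **Deliverable thresholds are incompatible with the endgame arithmetic — for every design and every
`ι`, in all four readings** (`c₃₄` printed / `0.5`-prefactor) × (`C₂₃₃` from (10.19) / literal (10.9)):
the bridge `mainOrderContradictionG_of_endgameArithmetic` against
`Section2AllIota.not_mainOrderContradictionG_all`. [folklore] -/
theorem not_endgameArithmetic_of_deliverable (p : PartIIIDesign) (w2 w3 w4 : ℂ) :
    (p.MainOrderDeliverable frakc2G C233 w2 w3 w4 → ¬ p.EndgameArithmetic) ∧
    (p.MainOrderDeliverable frakc2cG C233 w2 w3 w4 → ¬ p.EndgameArithmetic) ∧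
    (p.MainOrderDeliverable frakc2G C233lit w2 w3 w4 → ¬ p.EndgameArithmetic) ∧
    (p.MainOrderDeliverable frakc2cG C233lit w2 w3 w4 → ¬ p.EndgameArithmetic) := by
  have hall := not_mainOrderContradictionG_all w2 w3 w4
  have h0 : (0 : ℝ) ≤ C233 := by linarith [C233_bounds.1]
  have h0l : (0 : ℝ) ≤ C233lit := by linarith [C233lit_bounds.1]
  refine ⟨fun hd hA => hall.1 ?_, fun hd hA => hall.2.1 ?_, fun hd hA => hall.2.2.1 ?_,
    fun hd hA => hall.2.2.2 ?_⟩
  · exact p.mainOrderContradictionG_of_endgameArithmetic hA h0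
      (by linarith [p.C232G_le_of_deliverable hd, hA.2.2.2.2.1]) hd.h233 hd.h24
  · exact p.mainOrderContradictionG_of_endgameArithmetic hA h0
      (by linarith [p.C232cG_le_of_deliverable hd, hA.2.2.2.2.1]) hd.h233 hd.h24
  · exact p.mainOrderContradictionG_of_endgameArithmetic hA h0l
      (by linarith [p.C232G_le_of_deliverable hd, hA.2.2.2.2.1]) hd.h233 hd.h24
  · exact p.mainOrderContradictionG_of_endgameArithmetic hA h0l
      (by linarith [p.C232cG_le_of_deliverable hd, hA.2.2.2.2.1]) hd.h233 hd.h24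

/-- **No Part-III design is both admissible and main-order deliverable, for any `ι` and in any of the four
readings** — the row-layer statement of the cell's CANNOT-CLOSE for the terminal block (`Admissible` =
support ∧ shift ∧ endgame arithmetic; only the last conjunct is contradicted). [folklore] -/
theorem not_exists_admissible_deliverable :
    ¬ ∃ (p : PartIIIDesign) (w2 w3 w4 : ℂ), p.Admissible ∧
      (p.MainOrderDeliverable frakc2G C233 w2 w3 w4 ∨ p.MainOrderDeliverable frakc2cG C233 w2 w3 w4 ∨
        p.MainOrderDeliverable frakc2G C233lit w2 w3 w4 ∨ p.MainOrderDeliverable frakc2cG C233lit w2 w3 w4) := by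
  rintro ⟨p, w2, w3, w4, hA, hd⟩
  have h := p.not_endgameArithmetic_of_deliverable w2 w3 w4
  rcases hd with hd | hd | hd | hd
  · exact h.1 hd hA.2.2
  · exact h.2.1 hd hA.2.2
  · exact h.2.2.1 hd hA.2.2
  · exact h.2.2.2 hd hA.2.2

/-- The same over the LITERAL row block `EndgameRows` of `constraints/part3.json` (via
`endgameArithmetic_of_endgameRows`). [folklore] -/
theorem not_exists_endgameRows_deliverable :
    ¬ ∃ (p : PartIIIDesign) (w2 w3 w4 : ℂ), p.EndgameRows ∧
      (p.MainOrderDeliverable frakc2G C233 w2 w3 w4 ∨ p.MainOrderDeliverable frakc2cG C233 w2 w3 w4 ∨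
        p.MainOrderDeliverable frakc2G C233lit w2 w3 w4 ∨ p.MainOrderDeliverable frakc2cG C233lit w2 w3 w4) := by
  rintro ⟨p, w2, w3, w4, hR, hd⟩
  have hA := p.endgameArithmetic_of_endgameRows hR
  have h := p.not_endgameArithmetic_of_deliverable w2 w3 w4
  rcases hd with hd | hd | hd | hd
  · exact h.1 hd hA
  · exact h.2.1 hd hA
  · exact h.2.2.1 hd hA
  · exact h.2.2.2 hd hA

/-- Hence a deliverable design never reaches the abstract conclusion THROUGH the endgame arithmetic:
`conclusion_of_endgameArithmetic` has no deliverable instance (the conclusion itself, a statement about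
endgame data, is not thereby refuted — only this route to it). [folklore] -/
theorem not_admissible_of_deliverable (p : PartIIIDesign) {w2 w3 w4 : ℂ}
    (hd : p.MainOrderDeliverable frakc2G C233 w2 w3 w4) : ¬ p.Admissible := fun hA =>
  (p.not_endgameArithmetic_of_deliverable w2 w3 w4).1 hd hA.2.2

/-- **Robust form.** Even if the three `𝔠`-thresholds together undershoot the most favourable certified
constant `C232cG(ι)` by `δ` with `|δ| ≤ 0.014` — room for the manuscript's `ε`-terms (`|ε| < 10⁻⁵`), the
unreduced `𝔠₃` of (18.1) (`< 10⁻⁴` off), and any further correction of that size — the endgame arithmetic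
fails whenever `C₂₃₃ ≤ cJ` and `d24 ≤ |𝔡′(ι)+𝔡(ι)|` (`Section2AllIota.not_mainOrderContradictionG_robust`).
[folklore] -/
theorem not_endgameArithmetic_of_deliverable_robust (p : PartIIIDesign) (w2 w3 w4 : ℂ) {δ : ℝ}
    (hδ : |δ| ≤ 0.014) (hsum : C232cG w2 w3 w4 + δ ≤ p.B824 + p.B98 + 2 * p.B182)
    (h233 : C233 ≤ p.cJ) (h24 : p.d24 ≤ ‖dprimeG w3 + dfrakG w2 w3 w4‖) : ¬ p.EndgameArithmetic := by
  intro hA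
  have h0 : (0 : ℝ) ≤ C233 := by linarith [C233_bounds.1]
  exact (not_mainOrderContradictionG_robust w2 w3 w4 hδ).2.1
    (p.mainOrderContradictionG_of_endgameArithmetic hA h0 (by linarith [hA.2.2.2.2.1]) h233 h24)

/-- Under the LITERAL rows the (2.33)-threshold dominates `C₂₃₃` automatically: row III-18.03f, the last
of the block III-18.03b–f encoding the manuscript's own proof of (2.33), reads `2·4400/π < cJ`
(rationalised `2·4400·10⁵ < cJ·314159`), so `cJ > 2801.1 > 2547.04 > C233lit > C₂₃₃`; only that
conjunct is used. [folklore] -/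
theorem C233_lt_cJ_of_endgameRows (p : PartIIIDesign) (h : p.EndgameRows) : C233 < p.cJ ∧ C233lit < p.cJ := by
  obtain ⟨⟨_, _, _, _, _, _, _, h233⟩, _⟩ := h
  have h33 := C233_bounds.2
  have h33l := C233lit_bounds.2
  constructor <;> linarith

/-- **Row-block form with the fewest external inputs**: for the literal row block `EndgameRows`, the only
data the contradiction imports are the three `𝔠`-thresholds against the most favourable certified
`C232cG(ι)` (jointly, with `0.014` to spare) and Prop. 2.4's `d24 ≤ |𝔡′(ι) + 𝔡(ι)|`; (2.33) takes care
of itself (`C233_lt_cJ_of_endgameRows`). Every `ι`. [folklore] -/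
theorem not_endgameRows_of_thresholds (p : PartIIIDesign) (w2 w3 w4 : ℂ) {δ : ℝ} (hδ : |δ| ≤ 0.014)
    (hsum : C232cG w2 w3 w4 + δ ≤ p.B824 + p.B98 + 2 * p.B182)
    (h24 : p.d24 ≤ ‖dprimeG w3 + dfrakG w2 w3 w4‖) : ¬ p.EndgameRows := fun hR =>
  p.not_endgameArithmetic_of_deliverable_robust w2 w3 w4 hδ hsum (p.C233_lt_cJ_of_endgameRows hR).1.le h24
    (p.endgameArithmetic_of_endgameRows hR)

/-! ### The cycle is genuine: each side is satisfiable on its own -/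

/-- The printed design's (2.33) and Prop. 2.4 thresholds ARE deliverable at the printed `ι`:
`C₂₃₃ < 2546.85 ≤ 3000 = cJ` and `d24 = 5 < |𝔡′ + 𝔡|` (`Section10Certificate.C233_bounds`,
`Prop24Main_holds`); also `C233lit < 2547.04 ≤ 3000`. [folklore] -/
theorem printed_deliverable_tail :
    C233 ≤ printed.cJ ∧ C233lit ≤ printed.cJ ∧ printed.d24 ≤ ‖dprimeG iota3 + dfrakG iota2 iota3 iota4‖ := by
  have h5 : (5 : ℝ) < ‖dprime + dfrak‖ := Prop24Main_holds
  refine ⟨?_, ?_, ?_⟩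
  · have h := C233_bounds.2; norm_num [printed]; linarith
  · have h := C233lit_bounds.2; norm_num [printed]; linarith
  · rw [dprimeG_iota, dfrakG_iota]; norm_num [printed]; linarith

/-- … but its three `𝔠`-thresholds are NOT: they sum to `6.9955 + 6.9955 − 2·6.9951 = 0.0008`, below the
certified `C₂₃₂(ι) > 0.0309` (printed `c₃₄`) resp. `C232cG(ι) > 0.0249` for EVERY `ι`
(`Section18AllIota.C232G_gt`, `C232cG_gt`) — the row-layer form of `Section18AllIota.not_ineq232_any_iota`:
no choice of `ι` supplies (8.24) ∧ (9.8) ∧ (18.2) as printed. [folklore] -/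
theorem printed_not_deliverable (c233 : ℝ) (w2 w3 w4 : ℂ) :
    ¬ printed.MainOrderDeliverable frakc2G c233 w2 w3 w4 ∧
      ¬ printed.MainOrderDeliverable frakc2cG c233 w2 w3 w4 := by
  constructor
  · intro hd
    have h := printed.C232G_le_of_deliverable hd
    have g := C232G_gt w2 w3 w4
    norm_num [printed] at h
    linarith
  · intro hd
    have h := printed.C232cG_le_of_deliverable hd
    have g := C232cG_gt w2 w3 w4
    norm_num [printed] at h
    linarith

/-- The design with the three `𝔠`-thresholds RAISED to the certified main-order values at the printed `ι`
(`B824 = 7.06 ≥ 𝔠₁ = 7.0501…`, `B98 = 7 ≥ 𝔠₂ = 6.9949…`, `B182 = −6.99 ≥ Re 𝔠₃ = −6.9909…`), every other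
field as printed. [folklore] -/
def raised : PartIIIDesign := { printed with B824 := 7.06, B98 := 7, B182 := -6.99 }

/-- `raised` IS main-order deliverable at the printed `ι` (both `c₃₄` readings, `C₂₃₃` as printed):
`Section8Certificate.frakc1_re_bounds`, `Section18Certificate.frakc2_re_bounds` / `frakc2c_re_bounds` /
`frakc3r_re_bounds`, `Section10Certificate.C233_bounds`, `Prop24Main_holds`. [folklore] -/
theorem raised_deliverable :
    raised.MainOrderDeliverable frakc2G C233 iota2 iota3 iota4 ∧
      raised.MainOrderDeliverable frakc2cG C233 iota2 iota3 iota4 := by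
  have h1 := frakc1_re_bounds.2
  have h2 := frakc2_re_bounds.2
  have h2c := frakc2c_re_bounds.2
  have h3 := frakc3r_re_bounds.2
  have h33 := C233_bounds.2
  have h5 : (5 : ℝ) < ‖dprime + dfrak‖ := Prop24Main_holds
  have e824 : raised.B824 = 7.06 := rfl
  have e98 : raised.B98 = 7 := rfl
  have e182 : raised.B182 = -6.99 := rfl
  have ecJ : raised.cJ = 3000 := rfl
  have e24 : raised.d24 = 5 := rfl
  refine ⟨⟨?_, ?_, ?_, ?_, ?_⟩, ⟨?_, ?_, ?_, ?_, ?_⟩⟩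
  · rw [frakc1G_iota, e824]; linarith
  · rw [frakc2G_iota, e98]; linarith
  · rw [frakc3rG_iota, e182]; linarith
  · rw [ecJ]; linarith
  · rw [dprimeG_iota, dfrakG_iota, e24]; linarith
  · rw [frakc1G_iota, e824]; linarith
  · rw [frakc2cG_iota, e98]; linarith
  · rw [frakc3rG_iota, e182]; linarith
  · rw [ecJ]; linarith
  · rw [dprimeG_iota, dfrakG_iota, e24]; linarith

/-- … keeps the support/exponent and shift rows of Part III (they do not involve the thresholds) …
[folklore] -/
theorem raised_supportAdmissible_shiftDesign : raised.SupportAdmissible ∧ raised.ShiftDesign :=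
  ⟨printed_supportAdmissible, printed_shiftDesign⟩

/-- … and therefore FAILS the endgame arithmetic (by `not_endgameArithmetic_of_deliverable`; concretely
the row III-18.02b conjunct reads `7.06 + 7 − 13.98 = 0.08 < 0.001`), hence is not admissible: raising
the thresholds to what §§8, 9, 18 deliver breaks (2.32). [folklore] -/
theorem raised_not_endgameArithmetic : ¬ raised.EndgameArithmetic ∧ ¬ raised.Admissible :=
  ⟨(raised.not_endgameArithmetic_of_deliverable iota2 iota3 iota4).1 raised_deliverable.1,
    raised.not_admissible_of_deliverable raised_deliverable.1⟩

/-- The design `q232 = 0.1, c25 = 18, d24 = 19`, thresholds raised as in `raised`, all else printed: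
used to show that Prop. 2.4's certified size is load-bearing in the cycle. [folklore] -/
def dropH24 : PartIIIDesign := { raised with q232 := 0.1, c25 := 18, d24 := 19 }

/-- **Without Prop. 2.4's certified size `|𝔡′ + 𝔡| < 5.2991` the other hypotheses are jointly
satisfiable**: `dropH24` satisfies the endgame arithmetic (`√(0.1·3000) = √300 < 18 < 19`,
`0.08 < 0.1`, tent rows and `8800 < 3000π` as printed), the support and shift rows, and every
deliverability conjunct at the printed `ι` EXCEPT `h24` (`19 ≤ |𝔡′+𝔡|` is false:
`Section2MainOrder.dsum_norm_lt`). So the infeasibility is a cycle through (8.24)+(9.8)+(18.2) →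
III-18.02b → III-2.P25a/b → III-2.asm → Prop. 2.4 → the certificate `|𝔡′(ι)+𝔡(ι)|² ≤ 832·C₂₃₂(ι)`,
`C₂₃₃ > 2546.84`, not a single violated row. [folklore] -/
theorem dropH24_witness :
    dropH24.Admissible ∧
      (frakc1G iota2).re ≤ dropH24.B824 ∧ (frakc2G iota3 iota4).re ≤ dropH24.B98 ∧
      (frakc3rG iota2 iota3 iota4).re ≤ dropH24.B182 ∧ C233 ≤ dropH24.cJ ∧
      ¬ dropH24.d24 ≤ ‖dprimeG iota3 + dfrakG iota2 iota3 iota4‖ := by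
  have hd := raised_deliverable.1
  refine ⟨⟨printed_supportAdmissible, printed_shiftDesign, ?_⟩, hd.h824, hd.h98, hd.h182, hd.h233, ?_⟩
  · refine ⟨by norm_num [dropH24], by norm_num [dropH24, raised, printed], ?_, by norm_num [dropH24],
      by norm_num [dropH24, raised], by norm_num [dropH24, raised, printed],
      by norm_num [dropH24, raised, printed], ?_⟩
    · rw [show dropH24.q232 * dropH24.cJ = (300 : ℝ) by norm_num [dropH24, raised, printed],
        show dropH24.c25 = (18 : ℝ) by norm_num [dropH24], Real.sqrt_lt' (by norm_num)]
      norm_num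
    · have hπ := Real.pi_gt_three
      simp only [dropH24, raised, printed]
      nlinarith
  · rw [dprimeG_iota, dfrakG_iota, show dropH24.d24 = (19 : ℝ) by norm_num [dropH24]]
    have h := dsum_norm_lt
    intro h19
    linarith

end PartIIIDesign

end Literature.NumberTheory.LFunctions.Zhang2022
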